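import Literature.MathematicalPhysics.QuantumFieldTheory.Balaban1983to89.B9Eq3138StepDelta2Pi
import Literature.MathematicalPhysics.QuantumFieldTheory.Balaban1983to89.B9Thm312Positivity

/-!
# `Balaban1983to89.B9Thm312PositivityAssembled` — T. Bałaban, *Propagators for lattice gauge theories in a background field*, Commun. Math. Phys.
**99** (1985) 389–434 [Balaban1985BackgroundPropagators], Sect. D p. 423: THEOREM 3.12's CLAUSE «THEOREM 3.11 HOLDS FOR G₁» ASSEMBLED END TO END at
p10's matrix level — from Theorem 3.11 for `Δ_a` (`hΔa`), the Theorem 3.3 letters of `G₀ = Δ_a⁻¹` and `G₀D`, the Theorem 3.1 ∘ (3.49) letters of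
`T = I − DG′RD*` and `RG′D*`, the `Δ′_π` step letter `𝒯₁` with its factored identity `G₀Δ′_π = 𝒢∘𝒯₁` ((3.131)), [5]'s CONCRETE second-order form
`Δ⁽²⁾ = delta2 (calC …)` (r06 FILE 74) and the smallness `Mα₀ ≤ (2D)⁻¹` with `D` EXPLICIT: the block majorant of `G₀(Δ′_π + Δ⁽²⁾_π) = 𝒢∘(𝒯₁ + 𝒯₂)`
(r06 FILE 78) ⟹ the LEFT sup letter (r06 FILE 80 §8) ⟹ `G₁⁻¹ = G1inv` invertible, `G₁ > 0`, and the series (3.138) summing to `G₁` in the sup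
operator norm (r06 FILE 80 §3/§7); FILE 81 of the Sect. B–D programme of cell `lit-balaban`, seat r06 (B9 fold owner); rows **B9.Thm3.12**,
**B9.Eq3.138** (member cells; heads = the lead's word)

statement-level skeleton of published theorems with citation tags; proofs where landed; nothing here is a claim about the Yang–Mills mass gap

CITATION HEADER (lean-in-tree rule).  B9 = [Balaban1985BackgroundPropagators] (held `paper:balaban1985-cmp99-background-propagators`, journal
page = PDF page + 388).  p. 423 [PDF 35]: «This bound implies that the operators Δ⁽²⁾, Δ⁽²⁾_π are small in a proper sense, if α₀ is sufficiently
small. Similarly as in (3.130) we get G₁ = G₀(I − (Δ′_π + Δ⁽²⁾_π)G₀)⁻¹ = Σ_{n=0}^∞ G₀((Δ′_π + Δ⁽²⁾_π)G₀)ⁿ. (3.138) Estimates of the terms in this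
series are now a little bit more complicated. It is connected with the fact that we have derivatives in the operator Δ′_π + Δ⁽²⁾_π which have to
be applied either to the operator on the right, or on the left … the series (3.138) is convergent for α₀ restricted by a small, absolute
constant. … Theorem 3.12. If an external gauge field configuration U satisfies both regularity conditions (3.35), (3.36) for α₀ sufficiently
small, then Theorems 3.3, 3.10, 3.11 hold for the propagators G, G₁ …»; Theorem 3.11 p. 416 (positivity; its proof's step «G = G₀(I − R)⁻¹, R is
an operator with small norm»).  [4] = [Balaban1984PropagatorsII] (2.51)–(2.55) p. 232, (2.61) p. 234.  [5] = [Balaban1985Averaging] (149) p. 40.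

WHAT IS PROVED (kernel; theorems only — 0 `def`, 0 named fact, 0 sorry).
* `mulVecLin_G0_mul_step` — `G₀·((K − TᵀKT) + Δ⁽²⁾_π) = 𝒢∘(𝒯₁ + 𝒯₂)` as linear maps, from the `Δ′_π` identity letter `G₀Δ′_π = 𝒢∘𝒯₁` and FILE 78's
  `step2_factored` (`G₀Δ⁽²⁾_π = 𝒢∘𝒯₂`, `Δ` symmetric).
* **`hasMaj_G0_mul_step`** — the block majorant of `G₀(Δ′_π + Δ⁽²⁾_π)` between the sharp-block sup norms: `[max(1,κ_P)(B_G + B′_G)(c₁ + c₂)c_r]·(Mα₀)·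
  e^{−σd}` with `c₂ = θ₀e^{δ_TR}C_Tc_r(1 + B₁c_r)`, `θ₀ = 2dC₃‖τ‖(Σ_i‖e_i‖)M_e c₀·#lv` (FILE 78 `hasMaj_T2_concrete`, `hasMaj_G`; r16 `hasMaj_comp_exp`).
* **`thm312_posDef_G1_assembled`** — THE CLAUSE END TO END: `Δ_a = K + DRD* + aQ_bᵀQ_b > 0`, the letters above, `Mα₀ ≤ (2D)⁻¹` with
  `D = max(1,κ_P)(B_G + B′_G)(c₁ + c₂)c_r²` ⟹ for `𝒞 := ½Δ⁽²⁾` (so that `K − 2𝒞 = K − Δ⁽²⁾`, (3.128)/(3.136)): `G1inv K 𝒞 …` is invertible,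
  `G₁ = (G1inv …)⁻¹ > 0`, `G1inv … > 0`, and `Σ_n G₀((Δ′_π + Δ⁽²⁾_π)G₀)ⁿ` converges to `G₁` in the sup operator norm (FILE 80 `thm312_posDef_G1_left`,
  `eq3138_hasSum_posDef_left` fed through FILE 80 §8 `rowSum_le_of_hasMaj_exp`).

HONEST SCOPE / NOT CLAIMED.  (i) Letters = HYPOTHESES of printed exponential shape between block norms: `G₀ = Δ_a⁻¹` and `G₀D` (Theorem 3.3 for
`G₀`, row Thm3.3), `T` and `RG′D*` (Theorem 3.1 ∘ (3.49), (3.44)), the `Δ′_π` step `𝒯₁` with its identity (rows 3.120/3.131; r06 FILE 67 at the form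
level) — here ALL on the sharp-block sup norm `ofBlocks blk` of the real bond coordinates (print's state norms carry `|D*A|`-terms and Hölder
sizes, (3.131)/(3.43) — not modelled; located, zero weight); only the `Δ⁽²⁾` factor is [5]'s concrete form.  (ii) `G₀`, `Δ′_π = K − TᵀKT`,
`Δ⁽²⁾_π = TᵀΔ⁽²⁾T`, `𝒢 = G₀ ⊕ G₀D` are the ACTUAL matrices/linear maps; the smallness threshold is explicit and unoptimised.  (iii) One finite
lattice at a time; rates `4σ ≤ δ_T`, `3σ ≤ δ_G`.  (iv) Theorems 3.3/3.10 for `G₁` are FILES 76–78 / `B9SectDSup` / `B9SectDWalk` (letters).  NOT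
summit progress.

RELATED IN THE TREE, NOT DUPLICATED: r06 FILE 78 `B9Eq3138StepDelta2Pi` (USED: `step2_factored`, `hasMaj_T2_concrete`, `hasMaj_G`), FILE 80
`B9Thm312Positivity` (USED: `thm312_posDef_G1_left`, `eq3138_hasSum_posDef_left`, `rowSum_le_of_hasMaj_exp`, `piOp_transpose`), FILE 74
`B9Eq3134MatrixConcrete` (`calC`), pub-balaban `B9Thm311`, `B9SectDFP`, `B9Eq3152`, `B9Delta2Def134`, r16 `B11SectG`, pub-balaban r1 `B9SectDSup`.
Unit `lit-balaban-r06`, HOME `run/shared/lean/pub/lit-balaban/`.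
-/

noncomputable section

open scoped BigOperators Matrix

namespace Literature.MathematicalPhysics.QuantumFieldTheory.Balaban1983to89.B9Thm312PositivityAssembled

open Literature.MathematicalPhysics.QuantumFieldTheory.Balaban1983to89
open B11SectG B6RandomWalk B9SectDSup

section Assembled

open NormedSpace Finset Metric Filter
open B7Prop1Explicit B7Prop1Local B7Prop2Explicit B7Prop3Flat B7Prop4Flat B7Eq92Concrete B7Prop3GeneralLinear
  B7Prop4GeneralLevels B7Prop5GeneralOperators B7Prop5GeneralInduction B7Prop5GeneralLevels B7Ineq149Pairing B7Eq136SecondOrder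
  B9Ineq3137From149 B9Eq3134MatrixConcrete

variable {d : ℕ}
variable {𝔸 : Type*} [NormedRing 𝔸] [NormedAlgebra ℂ 𝔸] [CompleteSpace 𝔸] [NormOneClass 𝔸]

variable (L : ℕ) (hL : 2 ≤ L) {G : Subgroup 𝔸ˣ} (hG : AvgClosed d L G) (k : ℕ)
  (U₀ : B7Prop1Explicit.Site d → Fin d → 𝔸ˣ) (hU₀ : ∀ x κ, U₀ x κ ∈ G) {α₀ : ℝ} (hα : 0 < α₀)
  (hα3 : C0 d * α₀ ≤ 1 / 3) (hα4 : 4 * α₀ ≤ c2' d L) (h52 : pdev U₀ < α₀ * (((L : ℝ) ^ k)⁻¹) ^ 2)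
  {b : ℝ} (hb : 0 < b)
  (hsmall : Real.exp (4 * (800 * ((d : ℝ) + 1) ^ 2 * ((d : ℝ) + 4)) * α₀)
    * (1 + 8 * (131072 * ((d : ℝ) + 1) ^ 2) * ((L : ℝ) ^ k * b)) ≤ 2)
  (hc₃ : 4 * ((L : ℝ) ^ k * b) < c3 d L)
  (h145 : 8 * d * thetaGen d L α₀ * (L : ℝ)⁻¹ ^ 4 ≤ 1)
  (h155 : (2 * (L : ℝ) - 1) * (L : ℝ)⁻¹ ^ 2 + 2 * d * thetaGen d L α₀ * (L : ℝ)⁻¹ ^ 3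
    + 1 / 8 * (1 + 2 * d * thetaGen d L α₀ * (L : ℝ)⁻¹ ^ 2 + 2 * d * C3Gen d L * ((L : ℝ) ^ k * b)) * (L : ℝ)⁻¹ ^ 2 ≤ 1)
  (S : Finset (B7Prop1Explicit.Site d × Fin d))
  (lv : Finset ℕ) (T : ℕ → Finset (B7Prop1Explicit.Site d × Fin d)) (w : ℕ → B7Prop1Explicit.Site d × Fin d → ℝ)
  (K : ℕ → B7Prop1Explicit.Site d × Fin d → 𝔸)

variable {ι : Type} [Fintype ι] [DecidableEq ι] (e : ι → 𝔸) (τ : 𝔸 →L[ℝ] ℝ)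
variable {g : B6.Geometry} (blk : S × ι → g.Site)
variable {n m q : Type} [Fintype n] [Fintype m] [Fintype q] [DecidableEq n] [DecidableEq m]
variable {P : Type} [AddCommGroup P] [Module ℝ P]

/-- `G₀·((K − TᵀKT) + Δ⁽²⁾_π) = 𝒢∘(𝒯₁ + 𝒯₂)` as linear maps: the `Δ′_π` identity letter `G₀Δ′_π = 𝒢∘𝒯₁` plus FILE 78's `step2_factored` (`Δ`
symmetric). [cite: Balaban1985BackgroundPropagators, (3.138) p.423, (3.135) p.422] -/
theorem mulVecLin_G0_mul_step (C G0m S1m : Matrix (S × ι) (S × ι) ℝ) (Δ : Matrix n n ℝ) (hΔ : Δ.IsSymm) (Q : Matrix m n ℝ) (a : ℝ)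
    (D : Matrix (S × ι) n ℝ) {𝒯₁ : (S × ι → ℝ) →ₗ[ℝ] (S × ι → ℝ) × (n → ℝ)}
    (h1 : Matrix.mulVecLin G0m * Matrix.mulVecLin S1m = ((Matrix.mulVecLin G0m).coprod (Matrix.mulVecLin (G0m * D))) ∘ₗ 𝒯₁) :
    Matrix.mulVecLin (G0m * (S1m + B9Delta2Def134.delta2pi C Δ Q a D)) =
      ((Matrix.mulVecLin G0m).coprod (Matrix.mulVecLin (G0m * D))) ∘ₗ
        (𝒯₁ + ((Matrix.mulVecLin (B9Delta2Def134.delta2 C) ∘ₗ Matrix.mulVecLin (B9SectDFP.tOp Δ Q a D)).prod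
          (-(Matrix.mulVecLin (B9H163.R Δ Q a * B9H163.G' Δ Q a * Dᵀ) ∘ₗ
            (Matrix.mulVecLin (B9Delta2Def134.delta2 C) ∘ₗ Matrix.mulVecLin (B9SectDFP.tOp Δ Q a D)))))) := by
  rw [Matrix.mul_add, Matrix.mulVecLin_add, Matrix.mulVecLin_mul, Matrix.mulVecLin_mul, LinearMap.comp_add]
  have h2 := B9Eq3138StepDelta2Pi.step2_factored G0m C Δ Q a D hΔ
  rw [Module.End.mul_eq_comp] at h1 h2
  rw [h1, h2]

include hL hG hU₀ hα hα3 hα4 h52 hb hsmall hc₃ h145 h155 in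
/-- **THE BLOCK MAJORANT OF `G₀(Δ′_π + Δ⁽²⁾_π)`** between the sharp-block sup norms, from the letters (Theorem 3.3 for `G₀`, `G₀D`; Theorem 3.1 ∘
(3.49) for `T`, `RG′D*`; the `Δ′_π` step `𝒯₁`) and [5]'s concrete `Δ⁽²⁾` (FILE 78 `hasMaj_T2_concrete`): `[max(1,κ_P)(B_G + B′_G)((c₁ + c₂)Mα₀)c_r]·
e^{−σd}`, `c₂ = θ₀e^{δ_TR}C_Tc_r(1 + B₁c_r)`. [cite: Balaban1985BackgroundPropagators, (3.138) p.423, Thm 3.12 p.423]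
[cite: Balaban1984PropagatorsII, (2.52)–(2.55) p.232, (2.61) p.234] [cite: Balaban1985Averaging, (149) p.40] -/
theorem hasMaj_G0_mul_step (hd : 2 ≤ d) (hJ : ∀ j ∈ lv, j ≤ k) (hw : ∀ j ∈ lv, ∀ c ∈ T j, 0 ≤ w j c)
    {c₀ M Me : ℝ} (hc₀ : 0 ≤ c₀) (hM : 0 ≤ M) (hMe : 0 ≤ Me) (he : ∀ i, ‖e i‖ ≤ Me)
    (hK : ∀ j ∈ lv, ∀ c ∈ T j, w j c * ‖K j c‖ ≤ c₀ * M * α₀ * ((L : ℝ) ^ j) ^ (d - 2))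
    {R : ℝ} (hR : ∀ j ∈ lv, ∀ c ∈ T j, ∀ y y' : g.Site, BoxMeets L S blk j c y → BoxMeets L S blk j c y' → g.dist y y' ≤ R)
    (G0m S1m : Matrix (S × ι) (S × ι) ℝ) (Δ : Matrix n n ℝ) (hΔ : Δ.IsSymm) (Q : Matrix m n ℝ) (a : ℝ) (D : Matrix (S × ι) n ℝ)
    {bP : BlockNorm g (n → ℝ)} {𝒯₁ : (S × ι → ℝ) →ₗ[ℝ] (S × ι → ℝ) × (n → ℝ)} {c₁ CT B₁ BG BG' δT δG σ cr : ℝ}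
    (htri : B6RandomWalk.Triangle254 g) (hdist : ∀ y y' : g.Site, 0 ≤ g.dist y y') (hrow : RowSum g σ cr) (hcr : 0 ≤ cr)
    (hc₁ : 0 ≤ c₁) (hCT : 0 ≤ CT) (hB₁ : 0 ≤ B₁) (hBG : 0 ≤ BG) (hBG' : 0 ≤ BG') (hσ : 0 ≤ σ) (hσT : 4 * σ ≤ δT) (hσG : 3 * σ ≤ δG)
    (h1 : Matrix.mulVecLin G0m * Matrix.mulVecLin S1m = ((Matrix.mulVecLin G0m).coprod (Matrix.mulVecLin (G0m * D))) ∘ₗ 𝒯₁)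
    (hT1 : HasMaj (BlockNorm.ofBlocks g blk) (prodNorm (BlockNorm.ofBlocks g blk) bP) 𝒯₁
      (fun y y' => c₁ * (M * α₀) * Real.exp (-(δT * g.dist y y'))))
    (hT : HasMaj (BlockNorm.ofBlocks g blk) (BlockNorm.ofBlocks g blk) (Matrix.mulVecLin (B9SectDFP.tOp Δ Q a D))
      (fun y y' => CT * Real.exp (-(δT * g.dist y y'))))
    (hRG : HasMaj (BlockNorm.ofBlocks g blk) bP (Matrix.mulVecLin (B9H163.R Δ Q a * B9H163.G' Δ Q a * Dᵀ))
      (fun y y' => B₁ * Real.exp (-(δT * g.dist y y'))))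
    (hG0 : HasMaj (BlockNorm.ofBlocks g blk) (BlockNorm.ofBlocks g blk) (Matrix.mulVecLin G0m)
      (fun y y' => BG * Real.exp (-(δG * g.dist y y'))))
    (hG0D : HasMaj bP (BlockNorm.ofBlocks g blk) (Matrix.mulVecLin (G0m * D)) (fun y y' => BG' * Real.exp (-(δG * g.dist y y')))) :
    HasMaj (BlockNorm.ofBlocks g blk) (BlockNorm.ofBlocks g blk)
      (Matrix.mulVecLin (G0m * (S1m + B9Delta2Def134.delta2pi (calC L U₀ S lv T w K e τ) Δ Q a D)))
      (fun y y' => (max 1 bP.κ * (BG + BG') * ((c₁ +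
          (2 * d * C3Gen d L * ‖τ‖ * (∑ i, ‖e i‖) * Me * c₀ * lv.card) * Real.exp (δT * R) * CT * cr * (1 + B₁ * cr)) * (M * α₀)) * cr) *
        Real.exp (-(σ * g.dist y y'))) := by
  set θ₀ : ℝ := 2 * d * C3Gen d L * ‖τ‖ * (∑ i, ‖e i‖) * Me * c₀ * lv.card with hθ₀
  have hE : 0 ≤ ∑ i, ‖e i‖ := Finset.sum_nonneg fun i _ => norm_nonneg _
  have hC3 := C3Gen_nonneg d L
  have hθ₀0 : 0 ≤ θ₀ := by rw [hθ₀]; positivity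
  have hMα : 0 ≤ M * α₀ := mul_nonneg hM hα.le
  have hc₀M : 0 ≤ c₀ * M := mul_nonneg hc₀ hM
  -- 𝒯₂ with [5]'s Δ⁽²⁾ at rate δT − 2σ
  have hT2 := B9Eq3138StepDelta2Pi.hasMaj_T2_concrete L hL hG k U₀ hU₀ hα hα3 hα4 h52 hb hsmall hc₃ h145 h155 S lv T w K e τ blk hd hJ
    hw hc₀M hMe he hK hR htri hdist hrow hCT hB₁ (show (0 : ℝ) ≤ δT - 2 * σ by linarith) hσ (show δT - 2 * σ + 2 * σ ≤ δT by linarith) hT hRG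
  -- 𝒯₁ at the same rate, and the sum
  have hT1' := hT1.of_rate_le hdist (mul_nonneg hc₁ hMα) (show δT - 2 * σ ≤ δT by linarith)
  have hT12 := hT1'.add hT2
  set c₂ : ℝ := θ₀ * Real.exp (δT * R) * CT * cr * (1 + B₁ * cr) with hc₂
  have hc₂0 : 0 ≤ c₂ := by
    rw [hc₂]
    exact mul_nonneg (mul_nonneg (mul_nonneg (mul_nonneg hθ₀0 (Real.exp_nonneg _)) hCT) hcr) (by nlinarith)
  set 𝒯₂ : (S × ι → ℝ) →ₗ[ℝ] (S × ι → ℝ) × (n → ℝ) :=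
    (Matrix.mulVecLin (B9Delta2Def134.delta2 (calC L U₀ S lv T w K e τ)) ∘ₗ Matrix.mulVecLin (B9SectDFP.tOp Δ Q a D)).prod
      (-(Matrix.mulVecLin (B9H163.R Δ Q a * B9H163.G' Δ Q a * Dᵀ) ∘ₗ
        (Matrix.mulVecLin (B9Delta2Def134.delta2 (calC L U₀ S lv T w K e τ)) ∘ₗ Matrix.mulVecLin (B9SectDFP.tOp Δ Q a D)))) with h𝒯₂
  have hT12' : HasMaj (BlockNorm.ofBlocks g blk) (prodNorm (BlockNorm.ofBlocks g blk) bP) (𝒯₁ + 𝒯₂)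
      (fun y y' => (c₁ + c₂) * (M * α₀) * Real.exp (-((δT - 2 * σ) * g.dist y y'))) := by
    refine hT12.mono fun y y' => le_of_eq ?_
    rw [hc₂, hθ₀]; ring
  -- 𝒢 = G₀ ⊕ G₀D and the composition
  have hGG := B9Eq3138StepDelta2Pi.hasMaj_G hdist hBG hBG' hG0 hG0D
  have hcomp := hasMaj_comp_exp htri hdist hrow (add_nonneg hBG hBG') (mul_nonneg (add_nonneg hc₁ hc₂0) hMα) hσ
    (show σ ≤ δT - 2 * σ by linarith) (show σ + σ ≤ δG by linarith) hGG hT12'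
  rw [mulVecLin_G0_mul_step S (calC L U₀ S lv T w K e τ) G0m S1m Δ hΔ Q a D h1]
  have hκ : (prodNorm (BlockNorm.ofBlocks g blk) bP).κ = max 1 bP.κ := rfl
  refine hcomp.mono fun y y' => le_of_eq ?_
  rw [hκ, hc₂, hθ₀]

include hL hG hU₀ hα hα3 hα4 h52 hb hsmall hc₃ h145 h155 in
/-- **THEOREM 3.12's CLAUSE «THEOREM 3.11 HOLDS FOR G₁», ASSEMBLED END TO END** at p10's matrix level: `K` symmetric (the form `Δ` of ⟨A,ΔA⟩),
`Δ` symmetric, `Δ_a = K + DRD* + aQ_bᵀQ_b > 0` (Theorem 3.11; `G₀ := Δ_a⁻¹`), the letters of `hasMaj_G0_mul_step` for the ACTUAL `G₀`, `G₀D` and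
`Δ′_π = K − TᵀKT`, and the smallness `Mα₀ ≤ (2D)⁻¹`, `D = max(1,κ_P)(B_G + B′_G)(c₁ + c₂)c_r²` ⟹ with `𝒞 := ½Δ⁽²⁾` ([5]'s concrete form; `K − 2𝒞 =
K − Δ⁽²⁾`): `G1inv K 𝒞 …` is invertible, `(G1inv …)⁻¹ > 0`, `G1inv … > 0`, and `Σ_n G₀((Δ′_π + Δ⁽²⁾_π)G₀)ⁿ` converges to `(G1inv …)⁻¹` in the sup
operator norm. [cite: Balaban1985BackgroundPropagators, Thm 3.12 p.423, (3.138) p.423, Thm 3.11 p.416, (3.128) p.421]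
[cite: Balaban1984PropagatorsII, (2.52)–(2.55) p.232, (2.61) p.234] [cite: Balaban1985Averaging, (149) p.40] -/
theorem thm312_posDef_G1_assembled (hd : 2 ≤ d) (hJ : ∀ j ∈ lv, j ≤ k) (hw : ∀ j ∈ lv, ∀ c ∈ T j, 0 ≤ w j c)
    {c₀ M Me : ℝ} (hc₀ : 0 ≤ c₀) (hM : 0 ≤ M) (hMe : 0 ≤ Me) (he : ∀ i, ‖e i‖ ≤ Me)
    (hK : ∀ j ∈ lv, ∀ c ∈ T j, w j c * ‖K j c‖ ≤ c₀ * M * α₀ * ((L : ℝ) ^ j) ^ (d - 2))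
    {R : ℝ} (hR : ∀ j ∈ lv, ∀ c ∈ T j, ∀ y y' : g.Site, BoxMeets L S blk j c y → BoxMeets L S blk j c y' → g.dist y y' ≤ R)
    (Kb : Matrix (S × ι) (S × ι) ℝ) (hKb : Kbᵀ = Kb) (Δ : Matrix n n ℝ) (hΔ : Δ.IsSymm) (Q : Matrix m n ℝ) (a : ℝ) (D : Matrix (S × ι) n ℝ)
    (Qb : Matrix q (S × ι) ℝ) (ab : ℝ) (hΔa : (Kb + D * B9H163.R Δ Q a * Dᵀ + ab • (Qbᵀ * Qb)).PosDef)
    {bP : BlockNorm g (n → ℝ)} {𝒯₁ : (S × ι → ℝ) →ₗ[ℝ] (S × ι → ℝ) × (n → ℝ)} {c₁ CT B₁ BG BG' δT δG σ cr : ℝ}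
    (htri : B6RandomWalk.Triangle254 g) (hdist : ∀ y y' : g.Site, 0 ≤ g.dist y y') (hrow : RowSum g σ cr) (hcr : 0 ≤ cr)
    (hc₁ : 0 ≤ c₁) (hCT : 0 ≤ CT) (hB₁ : 0 ≤ B₁) (hBG : 0 ≤ BG) (hBG' : 0 ≤ BG') (hσ : 0 ≤ σ) (hσT : 4 * σ ≤ δT) (hσG : 3 * σ ≤ δG)
    (h1 : Matrix.mulVecLin (Kb + D * B9H163.R Δ Q a * Dᵀ + ab • (Qbᵀ * Qb))⁻¹ * Matrix.mulVecLin (Kb - B9SectDFP.piOp Kb Δ Q a D) =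
      ((Matrix.mulVecLin (Kb + D * B9H163.R Δ Q a * Dᵀ + ab • (Qbᵀ * Qb))⁻¹).coprod
        (Matrix.mulVecLin ((Kb + D * B9H163.R Δ Q a * Dᵀ + ab • (Qbᵀ * Qb))⁻¹ * D))) ∘ₗ 𝒯₁)
    (hT1 : HasMaj (BlockNorm.ofBlocks g blk) (prodNorm (BlockNorm.ofBlocks g blk) bP) 𝒯₁
      (fun y y' => c₁ * (M * α₀) * Real.exp (-(δT * g.dist y y'))))
    (hT : HasMaj (BlockNorm.ofBlocks g blk) (BlockNorm.ofBlocks g blk) (Matrix.mulVecLin (B9SectDFP.tOp Δ Q a D))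
      (fun y y' => CT * Real.exp (-(δT * g.dist y y'))))
    (hRG : HasMaj (BlockNorm.ofBlocks g blk) bP (Matrix.mulVecLin (B9H163.R Δ Q a * B9H163.G' Δ Q a * Dᵀ))
      (fun y y' => B₁ * Real.exp (-(δT * g.dist y y'))))
    (hG0 : HasMaj (BlockNorm.ofBlocks g blk) (BlockNorm.ofBlocks g blk)
      (Matrix.mulVecLin (Kb + D * B9H163.R Δ Q a * Dᵀ + ab • (Qbᵀ * Qb))⁻¹) (fun y y' => BG * Real.exp (-(δG * g.dist y y'))))
    (hG0D : HasMaj bP (BlockNorm.ofBlocks g blk) (Matrix.mulVecLin ((Kb + D * B9H163.R Δ Q a * Dᵀ + ab • (Qbᵀ * Qb))⁻¹ * D))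
      (fun y y' => BG' * Real.exp (-(δG * g.dist y y'))))
    (hsm : M * α₀ * (max 1 bP.κ * (BG + BG') * (c₁ +
        (2 * d * C3Gen d L * ‖τ‖ * (∑ i, ‖e i‖) * Me * c₀ * lv.card) * Real.exp (δT * R) * CT * cr * (1 + B₁ * cr)) * cr * cr) ≤ 1 / 2) :
    IsUnit (B9Eq3152.G1inv Kb ((1 / 2 : ℝ) • B9Delta2Def134.delta2 (calC L U₀ S lv T w K e τ)) Δ Q a D Qb ab).det ∧
    ((B9Eq3152.G1inv Kb ((1 / 2 : ℝ) • B9Delta2Def134.delta2 (calC L U₀ S lv T w K e τ)) Δ Q a D Qb ab)⁻¹).PosDef ∧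
    (B9Eq3152.G1inv Kb ((1 / 2 : ℝ) • B9Delta2Def134.delta2 (calC L U₀ S lv T w K e τ)) Δ Q a D Qb ab).PosDef ∧
    HasSum (fun n : ℕ => (Kb + D * B9H163.R Δ Q a * Dᵀ + ab • (Qbᵀ * Qb))⁻¹ *
        (((Kb - B9SectDFP.piOp Kb Δ Q a D) + B9Delta2Def134.delta2pi (calC L U₀ S lv T w K e τ) Δ Q a D) *
          (Kb + D * B9H163.R Δ Q a * Dᵀ + ab • (Qbᵀ * Qb))⁻¹) ^ n)
      (B9Eq3152.G1inv Kb ((1 / 2 : ℝ) • B9Delta2Def134.delta2 (calC L U₀ S lv T w K e τ)) Δ Q a D Qb ab)⁻¹ := by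
  set C2 : Matrix (S × ι) (S × ι) ℝ := B9Delta2Def134.delta2 (calC L U₀ S lv T w K e τ) with hC2
  set G0inv : Matrix (S × ι) (S × ι) ℝ := Kb + D * B9H163.R Δ Q a * Dᵀ + ab • (Qbᵀ * Qb) with hG0inv
  set Dc : ℝ := max 1 bP.κ * (BG + BG') * (c₁ +
        (2 * d * C3Gen d L * ‖τ‖ * (∑ i, ‖e i‖) * Me * c₀ * lv.card) * Real.exp (δT * R) * CT * cr * (1 + B₁ * cr)) * cr with hDc
  -- `𝒞 := ½Δ⁽²⁾` is symmetric and `2·piOp 𝒞 = Δ⁽²⁾_π`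
  have hC' : ((1 / 2 : ℝ) • C2)ᵀ = (1 / 2 : ℝ) • C2 := by rw [Matrix.transpose_smul, hC2, B9Delta2Def134.delta2_transpose]
  have hpi : (2 : ℝ) • B9SectDFP.piOp ((1 / 2 : ℝ) • C2) Δ Q a D = B9Delta2Def134.delta2pi (calC L U₀ S lv T w K e τ) Δ Q a D := by
    rw [B9Delta2Def134.delta2pi, ← hC2, B9SectDFP.piOp, B9SectDFP.piOp, Matrix.mul_smul, Matrix.smul_mul, smul_smul]
    norm_num
  -- the block majorant of `G₀(Δ′_π + Δ⁽²⁾_π)` and the LEFT sup letter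
  have hmaj := hasMaj_G0_mul_step L hL hG k U₀ hU₀ hα hα3 hα4 h52 hb hsmall hc₃ h145 h155 S lv T w K e τ blk hd hJ hw hc₀ hM hMe he hK hR
    G0inv⁻¹ (Kb - B9SectDFP.piOp Kb Δ Q a D) Δ hΔ Q a D htri hdist hrow hcr hc₁ hCT hB₁ hBG hBG' hσ hσT hσG h1 hT1 hT hRG hG0 hG0D
  have hE : 0 ≤ ∑ i, ‖e i‖ := Finset.sum_nonneg fun i _ => norm_nonneg _
  have hC3 := C3Gen_nonneg d L
  have hDc0 : 0 ≤ Dc := by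
    rw [hDc]
    refine mul_nonneg (mul_nonneg (mul_nonneg (le_trans zero_le_one (le_max_left _ _)) (add_nonneg hBG hBG')) (add_nonneg hc₁ ?_)) hcr
    exact mul_nonneg (mul_nonneg (mul_nonneg (mul_nonneg (by positivity) (Real.exp_nonneg _)) hCT) hcr) (by nlinarith)
  have hMα : 0 ≤ M * α₀ := mul_nonneg hM hα.le
  have hCc : 0 ≤ Dc * (M * α₀) := mul_nonneg hDc0 hMα
  have hmaj' : HasMaj (BlockNorm.ofBlocks g blk) (BlockNorm.ofBlocks g blk)
      (Matrix.mulVecLin (G0inv⁻¹ * ((Kb - B9SectDFP.piOp Kb Δ Q a D) + (2 : ℝ) • B9SectDFP.piOp ((1 / 2 : ℝ) • C2) Δ Q a D)))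
      (fun y y' => Dc * (M * α₀) * Real.exp (-(σ * g.dist y y'))) := by
    rw [hpi]
    refine hmaj.mono fun y y' => le_of_eq ?_
    rw [hDc]; ring
  have hrows : ∀ i, ∑ j, |(G0inv⁻¹ * ((Kb - B9SectDFP.piOp Kb Δ Q a D) + (2 : ℝ) • B9SectDFP.piOp ((1 / 2 : ℝ) • C2) Δ Q a D)) i j| ≤
      Dc * (M * α₀) * cr := fun i =>
    B9Thm312Positivity.rowSum_le_of_hasMaj_exp blk _ hCc hrow hmaj' i
  -- `ρ = D·c_r·Mα₀ ≤ ½ < 1`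
  have hρ : Dc * (M * α₀) * cr < 1 := by
    have : Dc * (M * α₀) * cr = M * α₀ * (Dc * cr) := by ring
    rw [this, hDc]
    linarith [hsm]
  have hρ0 : 0 ≤ Dc * (M * α₀) * cr := mul_nonneg hCc hcr
  obtain ⟨hdet, -, -, hpos, hpos'⟩ := B9Thm312Positivity.thm312_posDef_G1_left Kb ((1 / 2 : ℝ) • C2) hKb hC' Δ Q a D Qb ab hΔa hρ hrows
  have hser := (B9Thm312Positivity.eq3138_hasSum_posDef_left Kb ((1 / 2 : ℝ) • C2) hKb hC' Δ Q a D Qb ab hΔa hρ0 hρ hrows).1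
  rw [hpi] at hser
  exact ⟨hdet, hpos, hpos', hser⟩

end Assembled

end Literature.MathematicalPhysics.QuantumFieldTheory.Balaban1983to89.B9Thm312PositivityAssembled

end
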